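import Literature.Probability.RandomPlanarGeometry.SLEKappaRhoFlowIto
import Literature.Probability.RandomPlanarGeometry.SLERealAvoidance
import HarnessLib

/-!
# `sup_t (log g_t'(x) - log g_t'(y)) < ∞` a.s. for the SLE(κ, ρ) flows, `κ < 4`: the cut-off logarithmic supermartingale

Main stochastic step of the Koebe/log-derivative route to the named fact
`Literature.Probability.RandomPlanarGeometry.SLEKappaRho.ae_forall_ofReal_notMem_closure_hullUnion`
(`SLEKappaRhoFillVersion`; [LSW] Lemma 8.3 (2)–(3) with Thm. 8.4), after

* S. Rohde, O. Schramm, *Basic properties of SLE*, Ann. of Math. **161** (2005), proof of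
  Lemma 7.2 (p. 909): for `κ ≤ 4`, "it suffices to show that a.s. `sup_{t ≥ 0} Q(t) < ∞`",
  obtained from the local martingale `log g_t'(x) + c log X_t` of the real SLE flow;
* G. F. Lawler, O. Schramm, W. Werner, *Conformal restriction: the chordal case*, J. Amer. Math.
  Soc. **16** (2003), §8.3–8.4: the SLE(κ, ρ) driving function `W = √κ B + ρ ∫ du/Z_u`, so that
  the real flows solve `dX = (2/X - ρ J) dt - √κ dB`, `J = 1/Z ≥ 0`.

The tree runs Rohde–Schramm's argument for SLE_κ (`SLELogDerivMartingale`) by localising the two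
real flows `X ≥ Y` in a box along exit times. Here — for the SLE(κ, ρ) flows, whose paths are
continuous only almost surely — we avoid stopping times altogether: with the `C²` concave cut-off
logarithm `f = logCut δ` (`= log` on `[δ, ∞)`, `SLEKappaRhoLogCut`) and the martingales
`M^z_t = f(Z_t) - ∫₀ᵗ (L f)(Z_s, J_s) ds` of `SLEKappaRhoFlowIto` (`z = x, y`; `Z` the flow from
`z`), the observable `ℒ = c (M^x - M^y)`, `c = 4/(4 - κ)`, is a martingale with
`ℒ_0 = c log(x/y)`, and PATHWISE (a.s.), since `f` is non-decreasing and the generator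
`v ↦ (2/v) f' + (κ/2) f''` is non-increasing on `(0, ∞)` (`κ ≤ 4`):

  `ℒ_t + c K ≥ c ∫₀ᵗ (gen(Y_s) - gen(X_s)) ds ≥ 0`, and `= ∫₀ᵗ (2/Y² - 2/X²) ds` while `Y ≥ δ`,

whenever the CORRECTION FUNCTIONAL `logCutCorr = ρ ∫₀ᵗ J (φ(X) - φ(Y))`, `φ = f'`, is `≥ -K`
(`SLEKappaRho.RegularPair.integral_gen_le_logCutObs`, `…logDerivRaw_eq_integral_gen`). For `ρ ≤ 0`
one may take `K = 0` (`φ` antitone, `J ≥ 0`: `…logCutCorr_nonneg_of_nonpos`); for `ρ > 0` the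
bound `K = (ρ/2) log(x/y)` needs the process `g_t(x) - O_t` and is supplied by the sequel
`SLEKappaRhoLogDerivPos`. Markov's inequality then bounds
`P[{∫₀ᴺ (2/Y² - 2/X²) ≥ λ} ∩ {Y ≥ δ on [0, N]}] ≤ (c log(x/y) + c K)/λ` uniformly in `δ` and `N`
(`…measure_le_logDerivRaw_inter_box_le`); the boxes `δ = y/(m+2)` exhaust the event that `y` is
never swallowed, whence (`…ae_exists_forall_logDerivRaw_le`, `…ae_exists_forall_log_deriv_sub_le`):

**for `κ < 4`, a regular version whose correction functional is a.s. `≥ -K` at all levels, and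
`0 < y ≤ x` a.s. never swallowed, almost surely `sup_t (log |g_t'(x)| - log |g_t'(y)|) < ∞`**;
in particular for `ρ ≤ 0` (`…ae_exists_forall_log_deriv_sub_le_of_nonpos`).

No named fact is introduced.
-/

noncomputable section

open Set Filter Topology MeasureTheory
open scoped NNReal ENNReal
open Literature.Analysis.FunctionSpaces Literature.Probability.Process

namespace Literature.Probability.RandomPlanarGeometry

namespace SLEKappaRho

/-! ### The raw functional and the observable -/

/-- The **raw functional `D_t = ∫₀ᵗ (2/Y_s² - 2/X_s²) ds`** of the frozen real flows of the path
`s ↦ W s ω` from `y` and `x`; on `{T_y = ∞}` (`0 < y ≤ x`) it is `log g_t'(x) - log g_t'(y)`.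
[cite: RohdeSchramm2005, eq. (3.3)] -/
def logDerivRaw (W : ℝ≥0 → (ℝ≥0 → ℝ) → ℝ) (x y : ℝ) (t : ℝ≥0) (ω : ℝ≥0 → ℝ) : ℝ :=
  ∫ s in (0 : ℝ)..t, (2 / Loewner.realFlowStop (fun r ↦ W r ω) y s.toNNReal ^ 2 -
    2 / Loewner.realFlowStop (fun r ↦ W r ω) x s.toNNReal ^ 2)

/-- The martingale `M^z_t = logCut δ (Z_t) - ∫₀ᵗ logCutDrift κ ρ δ (Z_s) (J_s) ds` of the clamped
progressive flow `Z = flowReg W' z` (`RegularPair.martingale_logCut_flowReg`), as a function.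
[cite: RohdeSchramm2005, proof of Lemma 7.2 (p. 909)] -/
def logCutMart (κ : ℝ≥0) (ρ : ℝ) (W' J : ℝ≥0 → (ℝ≥0 → ℝ) → ℝ) (z δ : ℝ) (t : ℝ≥0) (ω : ℝ≥0 → ℝ) : ℝ :=
  logCut δ (flowReg W' z t ω) - timeIntegral (fun s ω ↦ logCutDrift κ ρ δ (flowReg W' z s ω) (J s ω)) t ω

/-- The **cut-off logarithmic observable** `ℒ = (4/(4-κ)) (M^x - M^y)`.
[cite: RohdeSchramm2005, proof of Lemma 7.2 (p. 909)] -/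
def logCutObs (κ : ℝ≥0) (ρ : ℝ) (W' J : ℝ≥0 → (ℝ≥0 → ℝ) → ℝ) (x y δ : ℝ) (t : ℝ≥0) (ω : ℝ≥0 → ℝ) : ℝ :=
  4 / (4 - (κ : ℝ)) * (logCutMart κ ρ W' J x δ t ω - logCutMart κ ρ W' J y δ t ω)

/-- The **correction functional** `ρ ∫₀ᵗ J_s (φ(X_s) - φ(Y_s)) ds`, `φ = logCutD δ`, of the frozen
real flows of the path `s ↦ W s ω` (the contribution of the SLE(κ, ρ) drift `-ρ J` to the
observable): non-negative for `ρ ≤ 0` (`φ` antitone, `J ≥ 0`), and bounded below by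
`-(ρ/2) log(x/y)` for `ρ > 0` (not in this file). [cite: LawlerSchrammWerner2003Restriction, §8.4 (p. 38)] -/
def logCutCorr (ρ δ : ℝ) (W J : ℝ≥0 → (ℝ≥0 → ℝ) → ℝ) (x y : ℝ) (t : ℝ≥0) (ω : ℝ≥0 → ℝ) : ℝ :=
  ∫ s in (0 : ℝ)..t, ρ * (J s.toNNReal ω *
    (logCutD δ (Loewner.realFlowStop (fun r ↦ W r ω) x s.toNNReal) -
      logCutD δ (Loewner.realFlowStop (fun r ↦ W r ω) y s.toNNReal)))

namespace RegularPair

variable {κ : ℝ≥0} {ρ : ℝ} {W W' J : ℝ≥0 → (ℝ≥0 → ℝ) → ℝ} {x y δ : ℝ}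

/-- **`ℒ` is a martingale** (difference of the two martingales of
`RegularPair.martingale_logCut_flowReg`, times `4/(4-κ)`), for `0 < y ≤ x` a.s. never swallowed and
`δ > 0`. [cite: RohdeSchramm2005, proof of Lemma 7.2 (p. 909)] -/
theorem martingale_logCutObs (h : RegularPair κ ρ W W' J) (hy : 0 < y) (hx : 0 < x) (hδ : 0 < δ)
    (hTx : ∀ᵐ ω ∂preWienerMeasure, Loewner.swallowingTime (fun s ↦ W s ω) x = ⊤)
    (hTy : ∀ᵐ ω ∂preWienerMeasure, Loewner.swallowingTime (fun s ↦ W s ω) y = ⊤) :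
    Martingale (logCutObs κ ρ W' J x y δ) brownianFiltration preWienerMeasure := by
  have hMx := h.martingale_logCut_flowReg hx hδ hTx
  have hMy := h.martingale_logCut_flowReg hy hδ hTy
  have hm := (hMx.sub hMy).smul (4 / (4 - (κ : ℝ)))
  refine (show (4 / (4 - (κ : ℝ))) • ((fun t ω ↦ logCut δ (flowReg W' x t ω) -
      timeIntegral (fun s ω ↦ logCutDrift κ ρ δ (flowReg W' x s ω) (J s ω)) t ω) -
      fun t ω ↦ logCut δ (flowReg W' y t ω) -
        timeIntegral (fun s ω ↦ logCutDrift κ ρ δ (flowReg W' y s ω) (J s ω)) t ω) =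
      logCutObs κ ρ W' J x y δ from ?_) ▸ hm
  funext t ω
  simp only [logCutObs, logCutMart, Pi.smul_apply, Pi.sub_apply, smul_eq_mul]

/-- `ℒ_0 = (4/(4-κ)) (log x - log y)` for `0 < δ ≤ y`, `δ ≤ x` (every sample). [folklore] -/
theorem logCutObs_zero (h : RegularPair κ ρ W W' J) (hδ : 0 < δ) (hδy : δ ≤ y) (hδx : δ ≤ x)
    (ω : ℝ≥0 → ℝ) : logCutObs κ ρ W' J x y δ 0 ω = 4 / (4 - (κ : ℝ)) * (Real.log x - Real.log y) := by
  have hy : 0 < y := hδ.trans_le hδy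
  have hx : 0 < x := hδ.trans_le hδx
  simp only [logCutObs, logCutMart, h.logCut_flowReg_zero hx, h.logCut_flowReg_zero hy,
    logCut_of_le hδ hδx, logCut_of_le hδ hδy]

/-! ### Pathwise analysis on a good sample -/

section Pathwise

variable {ω : ℝ≥0 → ℝ}

/-- The frozen real flows `0 < Y_s ≤ X_s` of a continuous path with `W 0 = 0`, `0 < y ≤ x`, `y` never
swallowed. [folklore] -/
theorem realFlowStop_pos_and_le {w : ℝ≥0 → ℝ} (hw : Continuous w) (hw0 : w 0 = 0) (hy : 0 < y)
    (hyx : y ≤ x) (hT : Loewner.swallowingTime w y = ⊤) (s : ℝ≥0) :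
    0 < Loewner.realFlowStop w y s ∧ Loewner.realFlowStop w y s ≤ Loewner.realFlowStop w x s := by
  have hy0 : w 0 < y := by rw [hw0]; exact hy
  have hsy : (s : WithTop ℝ≥0) < Loewner.swallowingTime w y := by rw [hT]; exact WithTop.coe_lt_top s
  have hsx : (s : WithTop ℝ≥0) < Loewner.swallowingTime w x :=
    lt_of_lt_of_le hsy (Loewner.swallowingTime_mono_right hw hy0 hyx)
  rw [Loewner.realFlowStop_of_lt hsy, Loewner.realFlowStop_of_lt hsx]
  exact ⟨Loewner.realFlow_pos hw hy0 hsy, Loewner.realFlow_mono_right hw hy0 hyx hsy⟩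

variable (h : RegularPair κ ρ W W' J) (hκ : κ < 4) (hδ : 0 < δ) (hy : 0 < y) (hyx : y ≤ x)
  (hc : Continuous fun s ↦ W s ω) (hW0 : W 0 ω = 0)
  (hT : Loewner.swallowingTime (fun s ↦ W s ω) y = ⊤)
  (hX : ∀ t, flowReg W' x t ω = Loewner.realFlowStop (fun s ↦ W s ω) x t)
  (hY : ∀ t, flowReg W' y t ω = Loewner.realFlowStop (fun s ↦ W s ω) y t)
  (hJ : ∀ t : ℝ≥0, IntervalIntegrable (fun s : ℝ ↦ J s.toNNReal ω) volume 0 t)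
include h hκ hδ hy hyx hc hW0 hT hX hY hJ

omit h in
/-- **The pathwise lower bound** (good sample, `κ < 4`): for all `t`,
`0 ≤ (4/(4-κ)) ∫₀ᵗ (gen(Y_s) - gen(X_s)) ds ≤ ℒ_t + (4/(4-κ)) K`, `gen = logCutGen κ δ`, whenever
the correction functional is `≥ -K` at time `t` — because `logCut δ` is non-decreasing (`X ≥ Y`),
and `-(drift(X) - drift(Y)) = (gen Y - gen X) + ρ J (φ X - φ Y)` (`gen` antitone on `(0, ∞)` for
`κ ≤ 4`). [cite: RohdeSchramm2005, proof of Lemma 7.2 (p. 909)] -/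
theorem integral_gen_le_logCutObs (t : ℝ≥0) {K : ℝ} (hK : -K ≤ logCutCorr ρ δ W J x y t ω) :
    0 ≤ 4 / (4 - (κ : ℝ)) * ∫ s in (0 : ℝ)..t,
        (logCutGen κ δ (Loewner.realFlowStop (fun r ↦ W r ω) y s.toNNReal) -
          logCutGen κ δ (Loewner.realFlowStop (fun r ↦ W r ω) x s.toNNReal)) ∧
      4 / (4 - (κ : ℝ)) * ∫ s in (0 : ℝ)..t,
        (logCutGen κ δ (Loewner.realFlowStop (fun r ↦ W r ω) y s.toNNReal) -
          logCutGen κ δ (Loewner.realFlowStop (fun r ↦ W r ω) x s.toNNReal)) ≤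
        logCutObs κ ρ W' J x y δ t ω + 4 / (4 - (κ : ℝ)) * K := by
  set w : ℝ≥0 → ℝ := fun r ↦ W r ω with hw
  set X : ℝ≥0 → ℝ := Loewner.realFlowStop w x with hXdef
  set Y : ℝ≥0 → ℝ := Loewner.realFlowStop w y with hYdef
  have hx : 0 < x := hy.trans_le hyx
  have hκ' : (κ : ℝ) < 4 := by exact_mod_cast hκ
  have hcpos : 0 < 4 / (4 - (κ : ℝ)) := div_pos (by norm_num) (by linarith)
  have hκ4 : (κ : ℝ) ≤ 4 := hκ'.le
  have hflows : ∀ s : ℝ≥0, 0 < Y s ∧ Y s ≤ X s := realFlowStop_pos_and_le hc hW0 hy hyx hT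
  have hy0 : w 0 < y := by simp only [hw, hW0]; exact hy
  have hx0 : w 0 < x := hy0.trans_le hyx
  have hXc : Continuous X := Loewner.continuous_realFlowStop hc hx0
  have hYc : Continuous Y := Loewner.continuous_realFlowStop hc hy0
  have hXc' : Continuous fun s : ℝ ↦ X s.toNNReal := hXc.comp continuous_real_toNNReal
  have hYc' : Continuous fun s : ℝ ↦ Y s.toNNReal := hYc.comp continuous_real_toNNReal
  -- continuity of the generator and of `φ` along the flows
  have hgenX : Continuous fun s : ℝ ↦ logCutGen κ δ (X s.toNNReal) :=
    (continuousOn_logCutGen hδ κ).comp_continuous hXc' fun s ↦ ((hflows _).1.trans_le (hflows _).2)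
  have hgenY : Continuous fun s : ℝ ↦ logCutGen κ δ (Y s.toNNReal) :=
    (continuousOn_logCutGen hδ κ).comp_continuous hYc' fun s ↦ (hflows _).1
  have hφX : Continuous fun s : ℝ ↦ logCutD δ (X s.toNNReal) := (continuous_logCutD hδ).comp hXc'
  have hφY : Continuous fun s : ℝ ↦ logCutD δ (Y s.toNNReal) := (continuous_logCutD hδ).comp hYc'
  -- integrability on `[0, t]`
  have hIgen : IntervalIntegrable (fun s : ℝ ↦ logCutGen κ δ (Y s.toNNReal) - logCutGen κ δ (X s.toNNReal))
      volume 0 t := (hgenY.sub hgenX).intervalIntegrable _ _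
  have hIJφ : IntervalIntegrable (fun s : ℝ ↦ ρ * (J s.toNNReal ω *
      (logCutD δ (X s.toNNReal) - logCutD δ (Y s.toNNReal)))) volume 0 t :=
    (((hJ t).mul_continuousOn (hφX.sub hφY).continuousOn)).const_mul ρ
  have hIdX : IntervalIntegrable (fun s : ℝ ↦ logCutDrift κ ρ δ (X s.toNNReal) (J s.toNNReal ω)) volume 0 t := by
    have : (fun s : ℝ ↦ logCutDrift κ ρ δ (X s.toNNReal) (J s.toNNReal ω)) =
        fun s ↦ logCutGen κ δ (X s.toNNReal) - ρ * (J s.toNNReal ω * logCutD δ (X s.toNNReal)) := by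
      funext s; simp only [logCutDrift]; ring
    rw [this]
    exact hgenX.intervalIntegrable _ _ |>.sub (((hJ t).mul_continuousOn hφX.continuousOn).const_mul ρ)
  have hIdY : IntervalIntegrable (fun s : ℝ ↦ logCutDrift κ ρ δ (Y s.toNNReal) (J s.toNNReal ω)) volume 0 t := by
    have : (fun s : ℝ ↦ logCutDrift κ ρ δ (Y s.toNNReal) (J s.toNNReal ω)) =
        fun s ↦ logCutGen κ δ (Y s.toNNReal) - ρ * (J s.toNNReal ω * logCutD δ (Y s.toNNReal)) := by
      funext s; simp only [logCutDrift]; ring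
    rw [this]
    exact hgenY.intervalIntegrable _ _ |>.sub (((hJ t).mul_continuousOn hφY.continuousOn).const_mul ρ)
  -- the decomposition of `ℒ_t`
  have hdecomp : logCutObs κ ρ W' J x y δ t ω = 4 / (4 - (κ : ℝ)) *
      ((logCut δ (X t) - logCut δ (Y t)) +
        ((∫ s in (0 : ℝ)..t, (logCutGen κ δ (Y s.toNNReal) - logCutGen κ δ (X s.toNNReal))) +
          ∫ s in (0 : ℝ)..t, ρ * (J s.toNNReal ω * (logCutD δ (X s.toNNReal) - logCutD δ (Y s.toNNReal))))) := by
    have h1 : timeIntegral (fun s ω ↦ logCutDrift κ ρ δ (flowReg W' x s ω) (J s ω)) t ω =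
        ∫ s in (0 : ℝ)..t, logCutDrift κ ρ δ (X s.toNNReal) (J s.toNNReal ω) := by
      simp only [timeIntegral, hX]
    have h2 : timeIntegral (fun s ω ↦ logCutDrift κ ρ δ (flowReg W' y s ω) (J s ω)) t ω =
        ∫ s in (0 : ℝ)..t, logCutDrift κ ρ δ (Y s.toNNReal) (J s.toNNReal ω) := by
      simp only [timeIntegral, hY]
    rw [logCutObs, logCutMart, logCutMart, h1, h2, hX t, hY t,
      ← intervalIntegral.integral_add hIgen hIJφ]
    have h3 : (∫ s in (0 : ℝ)..t, logCutDrift κ ρ δ (X s.toNNReal) (J s.toNNReal ω)) -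
        ∫ s in (0 : ℝ)..t, logCutDrift κ ρ δ (Y s.toNNReal) (J s.toNNReal ω) =
        -∫ s in (0 : ℝ)..t, ((logCutGen κ δ (Y s.toNNReal) - logCutGen κ δ (X s.toNNReal)) +
          ρ * (J s.toNNReal ω * (logCutD δ (X s.toNNReal) - logCutD δ (Y s.toNNReal)))) := by
      rw [← intervalIntegral.integral_sub hIdX hIdY, ← intervalIntegral.integral_neg]
      refine intervalIntegral.integral_congr fun s _ ↦ ?_
      simp only [logCutDrift]
      ring
    show 4 / (4 - (κ : ℝ)) * ((logCut δ (X t) - ∫ s in (0 : ℝ)..t, logCutDrift κ ρ δ (X s.toNNReal) (J s.toNNReal ω)) -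
        (logCut δ (Y t) - ∫ s in (0 : ℝ)..t, logCutDrift κ ρ δ (Y s.toNNReal) (J s.toNNReal ω))) = _
    rw [show (logCut δ (X t) - ∫ s in (0 : ℝ)..t, logCutDrift κ ρ δ (X s.toNNReal) (J s.toNNReal ω)) -
        (logCut δ (Y t) - ∫ s in (0 : ℝ)..t, logCutDrift κ ρ δ (Y s.toNNReal) (J s.toNNReal ω)) =
        (logCut δ (X t) - logCut δ (Y t)) - ((∫ s in (0 : ℝ)..t, logCutDrift κ ρ δ (X s.toNNReal) (J s.toNNReal ω)) -
          ∫ s in (0 : ℝ)..t, logCutDrift κ ρ δ (Y s.toNNReal) (J s.toNNReal ω)) by ring, h3]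
    ring
  -- signs
  have hf : 0 ≤ logCut δ (X t) - logCut δ (Y t) := sub_nonneg.2 (monotone_logCut hδ (hflows t).2)
  have hgen : 0 ≤ ∫ s in (0 : ℝ)..t, (logCutGen κ δ (Y s.toNNReal) - logCutGen κ δ (X s.toNNReal)) := by
    refine intervalIntegral.integral_nonneg t.coe_nonneg fun s _ ↦ sub_nonneg.2 ?_
    exact antitoneOn_logCutGen hδ hκ4 (hflows _).1 ((hflows _).1.trans_le (hflows _).2) (hflows _).2
  have hJφ : -K ≤ ∫ s in (0 : ℝ)..t, ρ * (J s.toNNReal ω * (logCutD δ (X s.toNNReal) - logCutD δ (Y s.toNNReal))) :=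
    hK
  refine ⟨mul_nonneg hcpos.le hgen, ?_⟩
  rw [hdecomp, ← mul_add]
  refine mul_le_mul_of_nonneg_left ?_ hcpos.le
  linarith

omit hκ hX hY hJ in
/-- **The correction functional is non-negative for `ρ ≤ 0`** on a good sample (`φ = logCutD δ` is
antitone and `Y ≤ X`, `J ≥ 0`). [cite: LawlerSchrammWerner2003Restriction, §8.4 (p. 38)] -/
theorem logCutCorr_nonneg_of_nonpos (hρ : ρ ≤ 0) (t : ℝ≥0) :
    0 ≤ logCutCorr ρ δ W J x y t ω := by
  have hflows : ∀ s : ℝ≥0, 0 < Loewner.realFlowStop (fun r ↦ W r ω) y s ∧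
      Loewner.realFlowStop (fun r ↦ W r ω) y s ≤ Loewner.realFlowStop (fun r ↦ W r ω) x s :=
    realFlowStop_pos_and_le hc hW0 hy hyx hT
  refine intervalIntegral.integral_nonneg t.coe_nonneg fun s _ ↦ ?_
  have h1 : logCutD δ (Loewner.realFlowStop (fun r ↦ W r ω) x s.toNNReal) -
      logCutD δ (Loewner.realFlowStop (fun r ↦ W r ω) y s.toNNReal) ≤ 0 :=
    sub_nonpos.2 (antitone_logCutD hδ (hflows _).2)
  exact mul_nonneg_of_nonpos_of_nonpos hρ (mul_nonpos_of_nonneg_of_nonpos (h.nonneg _ _) h1)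

omit h hX hY hJ in
/-- **In the box the cut-off is invisible**: if `δ ≤ Y_s` for all `s ≤ N`, then
`(4/(4-κ)) ∫₀ᴺ (gen(Y_s) - gen(X_s)) ds = ∫₀ᴺ (2/Y_s² - 2/X_s²) ds` (`gen(v) = (2 - κ/2)/v²` for
`v ≥ δ` and `(4/(4-κ)) (2 - κ/2) = 2`). [cite: RohdeSchramm2005, proof of Lemma 7.2 (p. 909)] -/
theorem logDerivRaw_eq_integral_gen {N : ℝ≥0}
    (hbox : ∀ s : ℝ≥0, s ≤ N → δ ≤ Loewner.realFlowStop (fun r ↦ W r ω) y s) :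
    4 / (4 - (κ : ℝ)) * ∫ s in (0 : ℝ)..N,
        (logCutGen κ δ (Loewner.realFlowStop (fun r ↦ W r ω) y s.toNNReal) -
          logCutGen κ δ (Loewner.realFlowStop (fun r ↦ W r ω) x s.toNNReal)) =
      logDerivRaw W x y N ω := by
  have hκ' : (κ : ℝ) < 4 := by exact_mod_cast hκ
  have hflows : ∀ s : ℝ≥0, 0 < Loewner.realFlowStop (fun r ↦ W r ω) y s ∧
      Loewner.realFlowStop (fun r ↦ W r ω) y s ≤ Loewner.realFlowStop (fun r ↦ W r ω) x s :=
    realFlowStop_pos_and_le hc hW0 hy hyx hT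
  rw [logDerivRaw, ← intervalIntegral.integral_const_mul]
  refine intervalIntegral.integral_congr fun s hs ↦ ?_
  rw [uIcc_of_le N.coe_nonneg] at hs
  have hsN : s.toNNReal ≤ N := Real.toNNReal_le_iff_le_coe.2 hs.2
  have hδY : δ ≤ Loewner.realFlowStop (fun r ↦ W r ω) y s.toNNReal := hbox _ hsN
  have hδX : δ ≤ Loewner.realFlowStop (fun r ↦ W r ω) x s.toNNReal := hδY.trans (hflows _).2
  have hY0 : Loewner.realFlowStop (fun r ↦ W r ω) y s.toNNReal ≠ 0 := (hflows _).1.ne'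
  have hX0 : Loewner.realFlowStop (fun r ↦ W r ω) x s.toNNReal ≠ 0 := ((hflows _).1.trans_le (hflows _).2).ne'
  simp only [logCutGen_of_le hδ κ hδY, logCutGen_of_le hδ κ hδX]
  have h4 : (4 : ℝ) - κ ≠ 0 := by linarith
  field_simp
  ring

omit h in
/-- Consequences on a good sample with correction functional `≥ -K`: `0 ≤ ℒ_t + (4/(4-κ)) K` for all
`t`, and `D_N ≤ ℒ_N + (4/(4-κ)) K` when `δ ≤ Y` on `[0, N]`. [cite: RohdeSchramm2005, proof of Lemma 7.2 (p. 909)] -/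
theorem logCutObs_nonneg_and_logDerivRaw_le (N : ℝ≥0) {K : ℝ} (hK : ∀ t, -K ≤ logCutCorr ρ δ W J x y t ω) :
    (∀ t, 0 ≤ logCutObs κ ρ W' J x y δ t ω + 4 / (4 - (κ : ℝ)) * K) ∧
      ((∀ s : ℝ≥0, s ≤ N → δ ≤ Loewner.realFlowStop (fun r ↦ W r ω) y s) →
        logDerivRaw W x y N ω ≤ logCutObs κ ρ W' J x y δ N ω + 4 / (4 - (κ : ℝ)) * K) := by
  refine ⟨fun t ↦ ?_, fun hbox ↦ ?_⟩
  · obtain ⟨h0, h1⟩ := integral_gen_le_logCutObs hκ hδ hy hyx hc hW0 hT hX hY hJ t (hK t)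
    exact h0.trans h1
  · rw [← logDerivRaw_eq_integral_gen hκ hδ hy hyx hc hW0 hT hbox]
    exact (integral_gen_le_logCutObs hκ hδ hy hyx hc hW0 hT hX hY hJ N (hK N)).2

end Pathwise

/-! ### Markov's inequality on the box events -/

/-- The good samples: continuous path with `W_0 = 0`, `y` never swallowed, both clamped progressive
flows equal to the frozen flows, `J` locally integrable — an almost sure event. [folklore] -/
theorem ae_good (h : RegularPair κ ρ W W' J) (hy : 0 < y) (hx : 0 < x)
    (hTy : ∀ᵐ ω ∂preWienerMeasure, Loewner.swallowingTime (fun s ↦ W s ω) y = ⊤) :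
    ∀ᵐ ω ∂preWienerMeasure, Continuous (fun s ↦ W s ω) ∧ W 0 ω = 0 ∧
      Loewner.swallowingTime (fun s ↦ W s ω) y = ⊤ ∧
      (∀ t, flowReg W' x t ω = Loewner.realFlowStop (fun s ↦ W s ω) x t) ∧
      (∀ t, flowReg W' y t ω = Loewner.realFlowStop (fun s ↦ W s ω) y t) ∧
      ∀ t : ℝ≥0, IntervalIntegrable (fun s : ℝ ↦ J s.toNNReal ω) volume 0 t := by
  filter_upwards [h.ae_continuous, h.ae_path_eq, hTy, h.ae_flowReg_eq hx, h.ae_flowReg_eq hy,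
    h.ae_intervalIntegrable] with ω hc heq hT hX hY hJ
  have heq0 : W 0 ω = 0 := by rw [← congrFun heq 0, h.apply_zero]
  exact ⟨heq ▸ hc, heq0, hT, hX, hY, hJ⟩

/-- **Tail bound on the box events**, uniformly in the level and the horizon: for `κ < 4`,
`ρ ≤ 0`, `0 < δ ≤ y ≤ x` with `x`, `y` a.s. never swallowed, and `λ > 0`,
`P[{λ ≤ D_N} ∩ {δ ≤ Y_s, s ≤ N}] ≤ (4/(4-κ)) log(x/y)/λ` — on the good samples the event lies in
`{λ ≤ ℒ_N}`, `ℒ_N ≥ 0` a.s., and `E ℒ_N = ℒ_0 = (4/(4-κ)) log(x/y)` (martingale).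
[cite: RohdeSchramm2005, proof of Lemma 7.2 (p. 909)] -/
theorem measure_le_logDerivRaw_inter_box_le (h : RegularPair κ ρ W W' J) (hκ : κ < 4)
    (hδ : 0 < δ) (hδy : δ ≤ y) (hyx : y ≤ x)
    (hTx : ∀ᵐ ω ∂preWienerMeasure, Loewner.swallowingTime (fun s ↦ W s ω) x = ⊤)
    (hTy : ∀ᵐ ω ∂preWienerMeasure, Loewner.swallowingTime (fun s ↦ W s ω) y = ⊤)
    {K : ℝ} (hK : ∀ᵐ ω ∂preWienerMeasure, ∀ t, -K ≤ logCutCorr ρ δ W J x y t ω)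
    (N : ℝ≥0) {lam : ℝ} (hlam : 0 < lam) :
    preWienerMeasure ({ω | lam ≤ logDerivRaw W x y N ω} ∩
        {ω | ∀ s : ℝ≥0, s ≤ N → δ ≤ Loewner.realFlowStop (fun r ↦ W r ω) y s}) ≤
      ENNReal.ofReal ((4 / (4 - (κ : ℝ)) * (Real.log x - Real.log y) + 4 / (4 - (κ : ℝ)) * K) / lam) := by
  haveI := isProbabilityMeasure_preWienerMeasure'
  have hy : 0 < y := hδ.trans_le hδy
  have hx : 0 < x := hy.trans_le hyx
  have hM' := h.martingale_logCutObs hy hx hδ hTx hTy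
  have hM : Martingale (fun t ω ↦ logCutObs κ ρ W' J x y δ t ω + 4 / (4 - (κ : ℝ)) * K)
      brownianFiltration preWienerMeasure := hM'.add (martingale_const _ _ _)
  set G : Set (ℝ≥0 → ℝ) := {ω | Continuous (fun s ↦ W s ω) ∧ W 0 ω = 0 ∧
      Loewner.swallowingTime (fun s ↦ W s ω) y = ⊤ ∧
      (∀ t, flowReg W' x t ω = Loewner.realFlowStop (fun s ↦ W s ω) x t) ∧
      (∀ t, flowReg W' y t ω = Loewner.realFlowStop (fun s ↦ W s ω) y t) ∧
      ∀ t : ℝ≥0, IntervalIntegrable (fun s : ℝ ↦ J s.toNNReal ω) volume 0 t} with hG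
  have hGae : ∀ᵐ ω ∂preWienerMeasure, ω ∈ G ∧ ∀ t, -K ≤ logCutCorr ρ δ W J x y t ω := by
    filter_upwards [h.ae_good hy hx hTy, hK] with ω h1 h2 using ⟨h1, h2⟩
  have hGc : preWienerMeasure {ω | ω ∈ G ∧ ∀ t, -K ≤ logCutCorr ρ δ W J x y t ω}ᶜ = 0 := by
    rw [ae_iff] at hGae
    exact hGae
  -- a.s. `ℒ_N + c K ≥ 0`
  have hnonneg : 0 ≤ᵐ[preWienerMeasure] fun ω ↦ logCutObs κ ρ W' J x y δ N ω + 4 / (4 - (κ : ℝ)) * K := by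
    filter_upwards [hGae] with ω ⟨⟨hc, hW0, hT, hX, hY, hJ⟩, hKω⟩
    exact ((logCutObs_nonneg_and_logDerivRaw_le hκ hδ hy hyx hc hW0 hT hX hY hJ N hKω).1 N)
  -- the event, on the good set, lies in `{λ ≤ ℒ_N + c K}`
  set S : Set (ℝ≥0 → ℝ) := {ω | lam ≤ logDerivRaw W x y N ω} ∩
    {ω | ∀ s : ℝ≥0, s ≤ N → δ ≤ Loewner.realFlowStop (fun r ↦ W r ω) y s} with hS
  have hsub : S ∩ {ω | ω ∈ G ∧ ∀ t, -K ≤ logCutCorr ρ δ W J x y t ω} ⊆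
      {ω | lam ≤ logCutObs κ ρ W' J x y δ N ω + 4 / (4 - (κ : ℝ)) * K} := by
    rintro ω ⟨⟨hl, hbox⟩, ⟨hc, hW0, hT, hX, hY, hJ⟩, hKω⟩
    exact hl.trans ((logCutObs_nonneg_and_logDerivRaw_le hκ hδ hy hyx hc hW0 hT hX hY hJ N hKω).2 hbox)
  have hmarkov := mul_meas_ge_le_integral_of_nonneg hnonneg (hM.integrable N) lam
  have hE : ∫ ω, logCutObs κ ρ W' J x y δ N ω + 4 / (4 - (κ : ℝ)) * K ∂preWienerMeasure =
      4 / (4 - (κ : ℝ)) * (Real.log x - Real.log y) + 4 / (4 - (κ : ℝ)) * K := by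
    rw [integral_eq_of_martingale hM N]
    simp only [h.logCutObs_zero hδ hδy (hδy.trans hyx), integral_const, smul_eq_mul, probReal_univ,
      one_mul]
  have hreal : preWienerMeasure.real {ω | lam ≤ logCutObs κ ρ W' J x y δ N ω + 4 / (4 - (κ : ℝ)) * K} ≤
      (4 / (4 - (κ : ℝ)) * (Real.log x - Real.log y) + 4 / (4 - (κ : ℝ)) * K) / lam := by
    rw [le_div_iff₀ hlam, mul_comm]
    rw [← hE]
    exact hmarkov
  calc preWienerMeasure S = preWienerMeasure (S ∩ {ω | ω ∈ G ∧ ∀ t, -K ≤ logCutCorr ρ δ W J x y t ω}) :=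
        (measure_inter_conull hGc).symm
    _ ≤ preWienerMeasure {ω | lam ≤ logCutObs κ ρ W' J x y δ N ω + 4 / (4 - (κ : ℝ)) * K} := measure_mono hsub
    _ = ENNReal.ofReal (preWienerMeasure.real {ω | lam ≤ logCutObs κ ρ W' J x y δ N ω + 4 / (4 - (κ : ℝ)) * K}) :=
        (ENNReal.ofReal_toReal (measure_ne_top _ _)).symm
    _ ≤ ENNReal.ofReal ((4 / (4 - (κ : ℝ)) * (Real.log x - Real.log y) + 4 / (4 - (κ : ℝ)) * K) / lam) :=
        ENNReal.ofReal_le_ofReal hreal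

/-! ### Exhaustion of `{T_y = ∞}` by the box events, and the almost sure bound -/

/-- On `{T_y = ∞}` (continuous path, `W_0 = 0`, `0 < y ≤ x`) the raw functional is non-decreasing
in `t` (its integrand `2/Y² - 2/X²` is non-negative and continuous). [folklore] -/
theorem logDerivRaw_mono {ω : ℝ≥0 → ℝ} (hc : Continuous fun s ↦ W s ω) (hW0 : W 0 ω = 0)
    (hy : 0 < y) (hyx : y ≤ x) (hT : Loewner.swallowingTime (fun s ↦ W s ω) y = ⊤) {t t' : ℝ≥0}
    (htt' : t ≤ t') : logDerivRaw W x y t ω ≤ logDerivRaw W x y t' ω := by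
  have hflows := realFlowStop_pos_and_le hc hW0 hy hyx hT
  have hy0 : (fun s ↦ W s ω) 0 < y := by simp only [hW0]; exact hy
  have hx0 : (fun s ↦ W s ω) 0 < x := hy0.trans_le hyx
  have hnn : ∀ r : ℝ, 0 ≤ 2 / Loewner.realFlowStop (fun s ↦ W s ω) y r.toNNReal ^ 2 -
      2 / Loewner.realFlowStop (fun s ↦ W s ω) x r.toNNReal ^ 2 := by
    intro r
    obtain ⟨h1, h2⟩ := hflows r.toNNReal
    exact sub_nonneg.2 (div_le_div_of_nonneg_left zero_le_two (pow_pos h1 2) (pow_le_pow_left₀ h1.le h2 2))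
  have hcont : Continuous fun r : ℝ ↦ 2 / Loewner.realFlowStop (fun s ↦ W s ω) y r.toNNReal ^ 2 -
      2 / Loewner.realFlowStop (fun s ↦ W s ω) x r.toNNReal ^ 2 := by
    refine (continuous_const.div (((Loewner.continuous_realFlowStop hc hy0).comp
      continuous_real_toNNReal).pow 2) fun r ↦ (pow_pos (hflows _).1 2).ne').sub
      (continuous_const.div (((Loewner.continuous_realFlowStop hc hx0).comp
      continuous_real_toNNReal).pow 2) fun r ↦ (pow_pos ((hflows _).1.trans_le (hflows _).2) 2).ne')
  exact intervalIntegral.integral_mono_interval le_rfl t.coe_nonneg (NNReal.coe_le_coe.2 htt')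
    (Eventually.of_forall hnn) (hcont.intervalIntegrable _ _)

/-- **On `{T_y = ∞}` the flow from `y` stays above some level `y/(m+2)` on `[0, N]`** (continuous
positive path on a compact interval). [folklore] -/
theorem exists_box {ω : ℝ≥0 → ℝ} (hc : Continuous fun s ↦ W s ω) (hW0 : W 0 ω = 0) (hy : 0 < y)
    (hT : Loewner.swallowingTime (fun s ↦ W s ω) y = ⊤) (N : ℝ≥0) :
    ∃ m : ℕ, ∀ s : ℝ≥0, s ≤ N → y / ((m : ℝ) + 2) ≤ Loewner.realFlowStop (fun r ↦ W r ω) y s := by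
  have hflows := realFlowStop_pos_and_le hc hW0 hy le_rfl hT
  have hy0 : (fun s ↦ W s ω) 0 < y := by simp only [hW0]; exact hy
  have hK : IsCompact (Icc (0 : ℝ≥0) N) := isCompact_Icc
  have hne : (Icc (0 : ℝ≥0) N).Nonempty := ⟨0, left_mem_Icc.2 bot_le⟩
  obtain ⟨s₀, -, hmin⟩ := hK.exists_isMinOn hne (Loewner.continuous_realFlowStop hc hy0).continuousOn
  set y₀ := Loewner.realFlowStop (fun r ↦ W r ω) y s₀ with hy₀
  have hy₀pos : 0 < y₀ := (hflows s₀).1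
  obtain ⟨m, hm⟩ := exists_nat_gt (y / y₀)
  refine ⟨m, fun s hs ↦ ?_⟩
  have hle : y / ((m : ℝ) + 2) ≤ y₀ := by
    rw [div_le_iff₀ (by positivity)]
    have := (div_lt_iff₀ hy₀pos).1 hm
    nlinarith
  exact hle.trans (hmin ⟨bot_le, hs⟩)

/-- **For `κ < 4`, `ρ ≤ 0` and `0 < y ≤ x` a.s. never swallowed, almost surely
`sup_t ∫₀ᵗ (2/Y_s² - 2/X_s²) ds < ∞`** — the box events `{y/(m+2) ≤ Y on [0, N]}` increase to
cover `{T_y = ∞}` (`exists_box`), each with the tail bound of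
`measure_le_logDerivRaw_inter_box_le`, so `P[{λ ≤ D_N} ∩ {T_y = ∞}] ≤ (4/(4-κ)) log(x/y)/λ` for
every `N`; the events `{λ ≤ D_N}` increase in `N` on `{T_y = ∞}` (`logDerivRaw_mono`), and
`λ → ∞`. This is Rohde–Schramm's "`sup_t Q(t) < ∞` a.s." for the SLE(κ, ρ) flows.
[cite: RohdeSchramm2005, proof of Lemma 7.2 (p. 909)] -/
theorem ae_exists_forall_logDerivRaw_le (h : RegularPair κ ρ W W' J) (hκ : κ < 4)
    (hy : 0 < y) (hyx : y ≤ x)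
    (hTx : ∀ᵐ ω ∂preWienerMeasure, Loewner.swallowingTime (fun s ↦ W s ω) x = ⊤)
    (hTy : ∀ᵐ ω ∂preWienerMeasure, Loewner.swallowingTime (fun s ↦ W s ω) y = ⊤)
    {K : ℝ} (hK : ∀ δ : ℝ, 0 < δ → δ ≤ y → ∀ᵐ ω ∂preWienerMeasure, ∀ t, -K ≤ logCutCorr ρ δ W J x y t ω) :
    ∀ᵐ ω ∂preWienerMeasure, ∃ L : ℝ, ∀ t : ℝ≥0, logDerivRaw W x y t ω ≤ L := by
  haveI := isProbabilityMeasure_preWienerMeasure'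
  set C : ℝ := 4 / (4 - (κ : ℝ)) * (Real.log x - Real.log y) + 4 / (4 - (κ : ℝ)) * K with hC
  -- the good set
  set G : Set (ℝ≥0 → ℝ) := {ω | Continuous (fun s ↦ W s ω) ∧ W 0 ω = 0 ∧
      Loewner.swallowingTime (fun s ↦ W s ω) y = ⊤} with hG
  have hGae : ∀ᵐ ω ∂preWienerMeasure, ω ∈ G := by
    filter_upwards [h.ae_good hy (hy.trans_le hyx) hTy] with ω hω
    exact ⟨hω.1, hω.2.1, hω.2.2.1⟩
  -- tail bound for `{λ ≤ D_N} ∩ G`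
  have htail : ∀ (N : ℝ≥0) {lam : ℝ}, 0 < lam →
      preWienerMeasure ({ω | lam ≤ logDerivRaw W x y N ω} ∩ G) ≤ ENNReal.ofReal (C / lam) := by
    intro N lam hlam
    set S : ℕ → Set (ℝ≥0 → ℝ) := fun m ↦ {ω | lam ≤ logDerivRaw W x y N ω} ∩
      {ω | ∀ s : ℝ≥0, s ≤ N → y / ((m : ℝ) + 2) ≤ Loewner.realFlowStop (fun r ↦ W r ω) y s} with hS
    have hSmono : Monotone S := by
      refine monotone_nat_of_le_succ fun m ω hω ↦ ⟨hω.1, fun s hs ↦ le_trans ?_ (hω.2 s hs)⟩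
      push_cast
      exact div_le_div_of_nonneg_left hy.le (by positivity) (by linarith)
    have hSm : ∀ m, preWienerMeasure (S m) ≤ ENNReal.ofReal (C / lam) := fun m ↦ by
      have hδ : 0 < y / ((m : ℝ) + 2) := by positivity
      have hδy : y / ((m : ℝ) + 2) ≤ y := by rw [div_le_iff₀ (by positivity)]; nlinarith
      exact measure_le_logDerivRaw_inter_box_le h hκ hδ hδy hyx hTx hTy (hK _ hδ hδy) N hlam
    have hcover : {ω | lam ≤ logDerivRaw W x y N ω} ∩ G ⊆ ⋃ m, S m := by
      rintro ω ⟨hω, hc, hW0, hT⟩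
      obtain ⟨m, hm⟩ := exists_box hc hW0 hy hT N
      exact mem_iUnion.2 ⟨m, hω, hm⟩
    exact (measure_mono hcover).trans (le_of_tendsto' (tendsto_measure_iUnion_atTop hSmono) hSm)
  -- the bad event
  set Bad : Set (ℝ≥0 → ℝ) := {ω | ω ∈ G ∧ ∀ L : ℕ, ∃ N : ℕ, (L : ℝ) + 1 ≤ logDerivRaw W x y N ω} with hBad
  have hBadle : ∀ L : ℕ, preWienerMeasure Bad ≤ ENNReal.ofReal (C / ((L : ℝ) + 1)) := by
    intro L
    set E : ℕ → Set (ℝ≥0 → ℝ) := fun N ↦ {ω | (L : ℝ) + 1 ≤ logDerivRaw W x y N ω} ∩ G with hE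
    have hEmono : Monotone E := by
      refine monotone_nat_of_le_succ fun N ω hω ↦ ⟨?_, hω.2⟩
      exact le_trans hω.1 (logDerivRaw_mono hω.2.1 hω.2.2.1 hy hyx hω.2.2.2 (by exact_mod_cast N.le_succ))
    have hsub : Bad ⊆ ⋃ N, E N := by
      rintro ω ⟨hωG, hω⟩
      obtain ⟨N, hN⟩ := hω L
      exact mem_iUnion.2 ⟨N, hN, hωG⟩
    refine (measure_mono hsub).trans (le_of_tendsto' (tendsto_measure_iUnion_atTop hEmono) fun N ↦ ?_)
    exact htail N (by positivity)
  have hBad0 : preWienerMeasure Bad = 0 := by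
    have hlim : Tendsto (fun L : ℕ ↦ ENNReal.ofReal (C / ((L : ℝ) + 1))) atTop (𝓝 0) := by
      rw [← ENNReal.ofReal_zero]
      refine ENNReal.tendsto_ofReal ?_
      have h1 := tendsto_one_div_add_atTop_nhds_zero_nat.const_mul C
      rw [mul_zero] at h1
      refine h1.congr fun L ↦ ?_
      ring
    exact le_antisymm (ge_of_tendsto' hlim hBadle) bot_le
  filter_upwards [hGae, measure_eq_zero_iff_ae_notMem.1 hBad0] with ω hωG hωBad
  have hex : ∃ L : ℕ, ∀ N : ℕ, logDerivRaw W x y N ω < (L : ℝ) + 1 := by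
    by_contra hcon
    push Not at hcon
    exact hωBad ⟨hωG, hcon⟩
  obtain ⟨L, hL⟩ := hex
  refine ⟨(L : ℝ) + 1, fun t ↦ ?_⟩
  have h1 := logDerivRaw_mono hωG.1 hωG.2.1 hy hyx hωG.2.2 (show t ≤ ((⌈(t : ℝ)⌉₊ : ℕ) : ℝ≥0) from by
    rw [← NNReal.coe_le_coe]; push_cast; exact Nat.le_ceil _)
  exact h1.trans (hL _).le

/-- **The same bound for `log |g_t'(x)| - log |g_t'(y)|`**: for `κ < 4`, `ρ ≤ 0` and `0 < y ≤ x`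
a.s. never swallowed, almost surely there is `L` with `log |g_t'(x)| - log |g_t'(y)| ≤ L` for all
`t` (on `{T_y = ∞}`, `log |g_t'(x)| - log |g_t'(y)| = ∫₀ᵗ (2/Y² - 2/X²)`,
`Loewner.log_norm_deriv_map_ofReal_sub_eq_integral`). [cite: RohdeSchramm2005, proof of Lemma 7.2 (p. 909)] -/
theorem ae_exists_forall_log_deriv_sub_le (h : RegularPair κ ρ W W' J) (hκ : κ < 4)
    (hy : 0 < y) (hyx : y ≤ x)
    (hTx : ∀ᵐ ω ∂preWienerMeasure, Loewner.swallowingTime (fun s ↦ W s ω) x = ⊤)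
    (hTy : ∀ᵐ ω ∂preWienerMeasure, Loewner.swallowingTime (fun s ↦ W s ω) y = ⊤)
    {K : ℝ} (hK : ∀ δ : ℝ, 0 < δ → δ ≤ y → ∀ᵐ ω ∂preWienerMeasure, ∀ t, -K ≤ logCutCorr ρ δ W J x y t ω) :
    ∀ᵐ ω ∂preWienerMeasure, ∃ L : ℝ, ∀ t : ℝ≥0,
      Real.log ‖deriv (Loewner.map (fun s ↦ W s ω) t) x‖ -
        Real.log ‖deriv (Loewner.map (fun s ↦ W s ω) t) y‖ ≤ L := by
  filter_upwards [h.ae_exists_forall_logDerivRaw_le hκ hy hyx hTx hTy hK,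
    h.ae_good hy (hy.trans_le hyx) hTy] with ω ⟨L, hL⟩ ⟨hc, hW0, hT, _, _, _⟩
  refine ⟨L, fun t ↦ ?_⟩
  have hy0 : (fun s ↦ W s ω) 0 < y := by simp only [hW0]; exact hy
  have hty : (t : WithTop ℝ≥0) < Loewner.swallowingTime (fun s ↦ W s ω) y := by
    rw [hT]; exact WithTop.coe_lt_top t
  have hTx' : Loewner.swallowingTime (fun s ↦ W s ω) x = ⊤ :=
    le_antisymm le_top (hT ▸ Loewner.swallowingTime_mono_right hc hy0 hyx)
  rw [Loewner.log_norm_deriv_map_ofReal_sub_eq_integral hc hy0 hyx hty]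
  have heq : (∫ s in (0 : ℝ)..t, (2 / Loewner.realFlow (fun s ↦ W s ω) y s.toNNReal ^ 2 -
      2 / Loewner.realFlow (fun s ↦ W s ω) x s.toNNReal ^ 2)) = logDerivRaw W x y t ω := by
    refine intervalIntegral.integral_congr fun s _ ↦ ?_
    show _ = 2 / Loewner.realFlowStop (fun r ↦ W r ω) y s.toNNReal ^ 2 -
      2 / Loewner.realFlowStop (fun r ↦ W r ω) x s.toNNReal ^ 2
    rw [Loewner.realFlowStop_of_lt (by rw [hT]; exact WithTop.coe_lt_top _),
      Loewner.realFlowStop_of_lt (by rw [hTx']; exact WithTop.coe_lt_top _)]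
  rw [heq]
  exact hL t

/-! ### The case `ρ ≤ 0`: the correction functional is non-negative -/

/-- For `ρ ≤ 0`, a.s. the correction functional is non-negative at all times and all levels
`δ > 0` (`logCutCorr_nonneg_of_nonpos` on the good samples). [cite: LawlerSchrammWerner2003Restriction, §8.4 (p. 38)] -/
theorem ae_logCutCorr_nonneg_of_nonpos (h : RegularPair κ ρ W W' J) (hρ : ρ ≤ 0) (hy : 0 < y)
    (hyx : y ≤ x) (hTy : ∀ᵐ ω ∂preWienerMeasure, Loewner.swallowingTime (fun s ↦ W s ω) y = ⊤)
    {δ : ℝ} (hδ : 0 < δ) :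
    ∀ᵐ ω ∂preWienerMeasure, ∀ t, -(0 : ℝ) ≤ logCutCorr ρ δ W J x y t ω := by
  filter_upwards [h.ae_good hy (hy.trans_le hyx) hTy] with ω ⟨hc, hW0, hT, _, _, _⟩ t
  rw [neg_zero]
  exact logCutCorr_nonneg_of_nonpos h hδ hy hyx hc hW0 hT hρ t

/-- **For `κ < 4`, `ρ ≤ 0` and `0 < y ≤ x` a.s. never swallowed, almost surely
`sup_t (log |g_t'(x)| - log |g_t'(y)|) < ∞`.** [cite: RohdeSchramm2005, proof of Lemma 7.2 (p. 909)] -/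
theorem ae_exists_forall_log_deriv_sub_le_of_nonpos (h : RegularPair κ ρ W W' J) (hκ : κ < 4)
    (hρ : ρ ≤ 0) (hy : 0 < y) (hyx : y ≤ x)
    (hTx : ∀ᵐ ω ∂preWienerMeasure, Loewner.swallowingTime (fun s ↦ W s ω) x = ⊤)
    (hTy : ∀ᵐ ω ∂preWienerMeasure, Loewner.swallowingTime (fun s ↦ W s ω) y = ⊤) :
    ∀ᵐ ω ∂preWienerMeasure, ∃ L : ℝ, ∀ t : ℝ≥0,
      Real.log ‖deriv (Loewner.map (fun s ↦ W s ω) t) x‖ -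
        Real.log ‖deriv (Loewner.map (fun s ↦ W s ω) t) y‖ ≤ L :=
  h.ae_exists_forall_log_deriv_sub_le hκ hy hyx hTx hTy (K := 0)
    fun _ hδ _ ↦ h.ae_logCutCorr_nonneg_of_nonpos hρ hy hyx hTy hδ

end RegularPair

end SLEKappaRho

end Literature.Probability.RandomPlanarGeometry

end
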